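import Summits.NavierStokesRegularity.NavierStokesRegularity.Theorems.LerayQuarterDissipationFiniteDissipationLiouvilleTraceHalfSpace
import Summits.NavierStokesRegularity.NavierStokesRegularity.Theorems.CalmSliceGateOneSymmetricSliceStubs
import Mathlib.MeasureTheory.Measure.Haar.InnerProductSpace
import HarnessLib

/-!
# Crux `FiniteDissipationLiouville` (stmt-NavierStokesRegularity-22144): backward uniqueness from
# one half-space IN EVERY DIRECTION — the final datum of a nonzero member of the stratum is
# nontrivial in every half-space `{⟪x, d⟫ > R₁}`

Theorems file of route `LerayQuarterDissipation` (lead prover g5; `--supports` the crux). The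
half-space trace leaf `eq_zero_of_trace_halfSpace_vanishing` (`…TraceHalfSpace`, direction `e₃`)
transported to an arbitrary direction `d = L⁻¹ e₃`, `L` a linear isometry of `ℝ³`, by the
`O(3)`-COVARIANCE OF THE STRATUM (seat ns-lqd-p2's `OneSymmetricSlice.Birth.stub_isometryPullback`:
the conjugate `y ↦ L (u(t, L⁻¹ y))` of a member of `𝒟_{C,K}` is a member of `𝒟_{C,K}`) and the
isometry invariance of the pairings (`∫⟪L u(t, L⁻¹x), φ(x)⟫ dx = ∫⟪u(t, y), L⁻¹ φ(L y)⟫ dy`).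
Navier–Stokes regularity is NOT proved by anything here; no summit is.

* `eq_zero_of_trace_halfSpace_vanishing_dir` — for every linear isometry `L` of `ℝ³`: if the
  trace of `u ∈ 𝒟_{C,K}` vanishes on the test fields supported in the half-space
  `{x | R₁ < ⟪x, L⁻¹ e₃⟫}`, then `u ≡ 0`. Every unit vector is `L⁻¹ e₃` for a suitable `L`, so this
  is the half-space leaf in every direction.
* `exists_halfSpace_trace_ne_zero_of_singular_dir` — PORTRAIT: the final datum of a singular
  member is nontrivial in every half-space `{⟪x, L⁻¹e₃⟫ > R₁}`; for the DSS wall: the homogeneous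
  datum `a(x̂)|x|⁻¹` is nonzero on EVERY open hemisphere.
-/

noncomputable section

-- the summit and its single sub-problem share the name (CONVENTIONS §1), as in every Theorems file
set_option linter.dupNamespace false

namespace Summit.NavierStokesRegularity.NavierStokesRegularity.Theorems.FiniteDissipationLiouville.Birth.Apex

open MeasureTheory Set Filter Topology Metric Function TopologicalSpace
open Literature.Analysis Literature.Analysis.FluidPDE
open scoped ENNReal NNReal RealInnerProductSpace

variable {C K : ℝ} {u : ℝ → EuclideanSpace ℝ (Fin 3) → EuclideanSpace ℝ (Fin 3)}

/-- **Pairings of the isometric conjugate**: `∫⟪L u(t, L⁻¹x), φ(x)⟫ dx = ∫⟪u(t, y), L⁻¹ φ(L y)⟫ dy`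
for a linear isometry `L` of `ℝ³`. -/
theorem integral_pairing_conj_linearIsometryEquiv
    (L : EuclideanSpace ℝ (Fin 3) ≃ₗᵢ[ℝ] EuclideanSpace ℝ (Fin 3)) (t : ℝ)
    (φ : EuclideanSpace ℝ (Fin 3) → EuclideanSpace ℝ (Fin 3)) :
    ∫ x, ⟪L (u t (L.symm x)), φ x⟫ = ∫ y, ⟪u t y, L.symm (φ (L y))⟫ := by
  have h1 : (fun x => ⟪L (u t (L.symm x)), φ x⟫) =
      fun x => (fun y => ⟪u t y, L.symm (φ (L y))⟫) (L.symm x) := by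
    funext x
    show ⟪L (u t (L.symm x)), φ x⟫ = ⟪u t (L.symm x), L.symm (φ (L (L.symm x)))⟫
    rw [LinearIsometryEquiv.apply_symm_apply, ← L.symm.inner_map_map (L (u t (L.symm x))) (φ x),
      LinearIsometryEquiv.symm_apply_apply]
  rw [h1]
  exact L.symm.measurePreserving.integral_comp L.symm.toHomeomorph.measurableEmbedding
    (fun y => ⟪u t y, L.symm (φ (L y))⟫)

/-- The conjugate test field `y ↦ L⁻¹ φ(L y)` is a test field, supported where `φ ∘ L` is. -/
theorem isTestFunctionOn_conj_linearIsometryEquiv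
    (L : EuclideanSpace ℝ (Fin 3) ≃ₗᵢ[ℝ] EuclideanSpace ℝ (Fin 3))
    {φ : EuclideanSpace ℝ (Fin 3) → EuclideanSpace ℝ (Fin 3)}
    (hφ : FunctionSpaces.IsTestFunctionOn (⊤ : Opens (EuclideanSpace ℝ (Fin 3))) φ) :
    FunctionSpaces.IsTestFunctionOn (⊤ : Opens (EuclideanSpace ℝ (Fin 3)))
      (fun y => L.symm (φ (L y))) :=
  { contDiff := L.symm.toContinuousLinearEquiv.contDiff.comp
      (hφ.contDiff.comp L.toContinuousLinearEquiv.contDiff)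
    hasCompactSupport := by
      have h1 : HasCompactSupport (fun y => φ (L y)) :=
        hφ.hasCompactSupport.comp_homeomorph L.toHomeomorph
      exact h1.comp_left (g := fun v => L.symm v) (map_zero _)
    tsupport_subset := fun y _ => Opens.mem_top y }

/-- **THE HALF-SPACE TRACE LEAF IN EVERY DIRECTION.** Let `L` be a linear isometry of `ℝ³` and
`d = L⁻¹ e₃`. If `u ∈ 𝒟_{C,K}` and `∫⟪u(t), φ⟫ → 0` as `t → 0⁻` for every test field `φ` supported
in the half-space `{x | R₁ < ⟪x, d⟫}`, then `u ≡ 0` on `t < 0`: the conjugate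
`v(t, x) = L u(t, L⁻¹ x)` is a member of `𝒟_{C,K}` (`OneSymmetricSlice.Birth.stub_isometryPullback`)
whose trace vanishes on `{x₃ > R₁}`, hence `v ≡ 0` by `eq_zero_of_trace_halfSpace_vanishing`. -/
theorem eq_zero_of_trace_halfSpace_vanishing_dir (hu : IsTypeIAncientMild C u)
    (hlaw : ∀ s : ℝ, s < 0 → ∫⁻ x, ‖fderiv ℝ (u s) x‖ₑ ^ 2 ≤ ENNReal.ofReal (K / Real.sqrt (-s)))
    (L : EuclideanSpace ℝ (Fin 3) ≃ₗᵢ[ℝ] EuclideanSpace ℝ (Fin 3)) {R₁ : ℝ}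
    (hfinal : ∀ φ : EuclideanSpace ℝ (Fin 3) → EuclideanSpace ℝ (Fin 3),
      FunctionSpaces.IsTestFunctionOn (⊤ : Opens (EuclideanSpace ℝ (Fin 3))) φ →
        (∀ x, φ x ≠ 0 → R₁ < ⟪x, L.symm (EuclideanSpace.basisFun (Fin 3) ℝ 2)⟫) →
        Tendsto (fun t => ∫ x, ⟪u t x, φ x⟫) (𝓝[<] 0) (𝓝 0)) :
    ∀ t < 0, ∀ x, u t x = 0 := by
  -- the conjugate member `v(t, x) = L u(t, L⁻¹ x)`
  obtain ⟨hv, hvlaw⟩ := OneSymmetricSlice.Birth.stub_isometryPullback C K u hu hlaw L.symm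
  simp only [LinearIsometryEquiv.symm_symm] at hv hvlaw
  -- its trace vanishes on `{x₃ > R₁}`
  have hcoord : ∀ y : EuclideanSpace ℝ (Fin 3),
      (L y) 2 = ⟪y, L.symm (EuclideanSpace.basisFun (Fin 3) ℝ 2)⟫ := fun y => by
    have h1 : (L y) 2 = ⟪L y, EuclideanSpace.basisFun (Fin 3) ℝ 2⟫ := by
      rw [EuclideanSpace.basisFun_apply, EuclideanSpace.inner_single_right]
      simp
    rw [h1, ← L.symm.inner_map_map (L y), LinearIsometryEquiv.symm_apply_apply]
  have hfinal' : ∀ φ : EuclideanSpace ℝ (Fin 3) → EuclideanSpace ℝ (Fin 3),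
      FunctionSpaces.IsTestFunctionOn (⊤ : Opens (EuclideanSpace ℝ (Fin 3))) φ →
        (∀ x, φ x ≠ 0 → R₁ < x 2) →
        Tendsto (fun t => ∫ x, ⟪(fun t x => L (u t (L.symm x))) t x, φ x⟫) (𝓝[<] 0) (𝓝 0) := by
    intro φ hφ hsupp
    have hψsupp : ∀ y, L.symm (φ (L y)) ≠ 0 →
        R₁ < ⟪y, L.symm (EuclideanSpace.basisFun (Fin 3) ℝ 2)⟫ := fun y hy => by
      have hφy : φ (L y) ≠ 0 := fun h0 => hy (by rw [h0, map_zero])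
      rw [← hcoord]
      exact hsupp _ hφy
    refine (hfinal _ (isTestFunctionOn_conj_linearIsometryEquiv L hφ) hψsupp).congr fun t => ?_
    exact (integral_pairing_conj_linearIsometryEquiv L t φ).symm
  have hzero := eq_zero_of_trace_halfSpace_vanishing hv hvlaw hfinal'
  intro t ht x
  have h := hzero t ht (L x)
  have h' : L (u t x) = 0 := by simpa [LinearIsometryEquiv.symm_apply_apply] using h
  exact (LinearIsometryEquiv.map_eq_zero_iff L).1 h'

/-- **PORTRAIT ENTRY (both stubs), every direction**: for every linear isometry `L` of `ℝ³` and
every `R₁`, the final datum of a SINGULAR member of the stratum has a nonzero value on some test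
field supported in the half-space `{⟪x, L⁻¹e₃⟫ > R₁}`. For the DSS wall: the homogeneous datum
`a(x̂)|x|⁻¹` is nonzero on every open hemisphere. -/
theorem exists_halfSpace_trace_ne_zero_of_singular_dir (hu : IsTypeIAncientMild C u)
    (hlaw : ∀ s : ℝ, s < 0 → ∫⁻ x, ‖fderiv ℝ (u s) x‖ₑ ^ 2 ≤ ENNReal.ofReal (K / Real.sqrt (-s)))
    (hsing : ∀ r > 0, ∀ M : ℝ, ∃ t ∈ Set.Ioo (-(r ^ 2)) (0 : ℝ),
      ∃ x ∈ Metric.ball (0 : EuclideanSpace ℝ (Fin 3)) r, M < ‖u t x‖)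
    (L : EuclideanSpace ℝ (Fin 3) ≃ₗᵢ[ℝ] EuclideanSpace ℝ (Fin 3)) (R₁ : ℝ) :
    ∃ (φ : EuclideanSpace ℝ (Fin 3) → EuclideanSpace ℝ (Fin 3)) (T : ℝ),
      FunctionSpaces.IsTestFunctionOn (⊤ : Opens (EuclideanSpace ℝ (Fin 3))) φ ∧
        (∀ x, φ x ≠ 0 → R₁ < ⟪x, L.symm (EuclideanSpace.basisFun (Fin 3) ℝ 2)⟫) ∧ T ≠ 0 ∧
        Tendsto (fun t => ∫ x, ⟪u t x, φ x⟫) (𝓝[<] 0) (𝓝 T) := by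
  by_contra h
  push Not at h
  obtain ⟨t, ht, x, -, hM⟩ := hsing 1 one_pos 0
  have hzero : u t x = 0 := by
    refine eq_zero_of_trace_halfSpace_vanishing_dir hu hlaw L (R₁ := R₁) (fun φ hφ hsupp => ?_)
      t ht.2 x
    obtain ⟨T, hT⟩ := exists_tendsto_pairing_finalSlice hu hlaw hφ
    have hT0 : T = 0 := by
      by_contra hT0
      exact h φ T hφ hsupp hT0 hT
    rwa [hT0] at hT
  rw [hzero, norm_zero] at hM
  exact lt_irrefl _ hM

end Summit.NavierStokesRegularity.NavierStokesRegularity.Theorems.FiniteDissipationLiouville.Birth.Apex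

end
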